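import Summits.HodgeConjecture.CorCM.HCCMIffWeilFaceLines
import HarnessLib

/-!
# For complex abelian varieties of CM type, the Hodge conjecture in CODIMENSION TWO implies the Hodge
# conjecture — `HC_CM ⟺ HC_CM|_{H⁴}`, in the kernel

COR-CM (cell `pub-hodgecm2`), seat b24, count-neutral lane SLICE-EXHAUSTION, part 4 (theorems only, no definition, no
named fact).  Part 3 (`HCCMIffWeilFaceLines`) identified `HC_CM` with `W_RK4` on the Picard–CM model universe: the
algebraicity of the Weil `F`-lines `W_F(P(f)) ⊂ H⁴(P(f), ℚ)` of the corner products `P(f) = A_{Φ₁} × A_{Φ₂} × A_{Φ₃} × A_{Φ₄}`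
of the rank-four faces of the Galois CM fields `F` of degree `≥ 6`.  Those are rational `(2,2)`-classes on complex abelian
varieties of CM type (of dimension `2[F:ℚ] ≥ 12`, `dim_cmProdAV`).  Hence:

* `universeOf_hodgeClassesOf_le_alg_of_forall` — per-degree comparison: codimension-`p` HC on the interpretation of a code
  `X` gives `U.hodgeClassesOf X p ≤ U.alg X p` in the model universe (Milne 1999 p. 72 read pointwise, as in
  `Milne1999.hodgeClasses_le_ratAlgebraicClasses_iff_hodgeConjectureFor`);
* **`w_rk4_of_codimTwo`** — if every rational `(2,2)`-class on every complex abelian variety of CM type is algebraic, then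
  `U.W_RK4` for every instance of the model universe; **`hc_cm_of_codimTwo`**, **`hc_cm_iff_codimTwo`** —
  **`HC_CM ⟺ ∀ A` of CM type, `∀ c ∈ H⁴(A(ℂ); ℂ)` rational of Hodge type `(2,2)`, `c` is algebraic**;
* **`hc_cm_iff_codimTwo_cmProdAV`** — the same with `A` restricted to the products `∏_{j<4} A_{(F,Θ_j)}` of FOUR chosen
  realisations of CM types of one Galois CM field `F` with `[F:ℚ] ≥ 6` (abelian varieties of dimension `2[F:ℚ]`).

The mathematics is the 2001 programme's face reduction ([QW8] Thm 2.5 with the lattice statement `l:allg`, kernel in the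
tree as `StubTree.faceReduction_holds` / `Model.universeOf_faceReduction_of_riemann`) composed with Pohlmann's span theorem,
André's/Milne's reduction to one Galois CM field, and parts 1–3 of this lane.  Nothing here asserts `HC_CM` or its
codimension-two case.

## References
* [Pohlmann1968] H. Pohlmann, Ann. of Math. 88 (1968), Thm. 1.
* [Andre1992HodgeCM] Y. André, Progr. Math. 102 (1992), Théorème pp. 4–5.
* [Milne2020HodgeClassesAV] J. S. Milne, *Hodge classes on abelian varieties* (2020), Theorem 1.
* [Milne1999] J. S. Milne, Compositio Math. 117 (1999), §7 p. 72.
* [Deligne1982HodgeCycles] P. Deligne, LNM 900 (1982), §4–§5.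
-/

noncomputable section

open CategoryTheory NumberField
open Literature.AlgebraicGeometry Literature.AlgebraicGeometry.Motives Literature.AlgebraicGeometry.HodgeTheory
open Literature.AlgebraicGeometry.ComplexMultiplication Literature.AlgebraicGeometry.Milne1999
open Literature.NumberTheory.Automorphic
open Literature.NumberTheory.Automorphic.PicardCM (BallQuotientUniformisedDatum CMAbelianVarietyRealised
  BallQuotientUniformised ballQuotientUniformisedDatum_of cmRealisation)
open Summit.HodgeConjecture.CorCM.Domination
open Summit.HodgeConjecture.CorCM.Model

namespace Summit.HodgeConjecture.CorCM.SliceExhaustion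

variable {F : Type} [Field F] [NumberField F] [IsCMField F]

/-! ## §1 Dimensions -/

/-- The chosen realisation `A_{(F,Φ)}` has dimension `[F:ℚ]/2`. [cite: Shimura1998, §6.2 Theorem 3 (pp. 41–42)] -/
theorem dim_cmAV (h₃ : CMAbelianVarietyRealised) (Φ : CMType F) :
    (cmRealisation h₃ (cmCode F Φ)).AV.dim = Module.finrank ℚ F / 2 :=
  Motives.schemeDim_eq_holds (isCMTypeRealisation_cmCode F h₃ Φ).1

/-- `dim ∏_{j ≤ n} A_{(F,Θ_j)} = (n+1) · [F:ℚ]/2`. [cite: MumfordAV1970, §19] -/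
theorem dim_cmProdAV (h₃ : CMAbelianVarietyRealised) :
    ∀ (n : ℕ) (Θ : Fin (n + 1) → CMType F), (cmProdAV F h₃ n Θ).dim = (n + 1) * (Module.finrank ℚ F / 2)
  | 0, Θ => by rw [cmProdAV_zero, dim_cmAV, zero_add, one_mul]
  | n + 1, Θ => by rw [cmProdAV_succ, AbelianVariety.dim_prod, dim_cmProdAV h₃ n, dim_cmAV]; ring

/-- The corner products of faces have dimension `2[F:ℚ]` (four realisations, `[F:ℚ]` even). [cite: MumfordAV1970, §19] -/
theorem dim_cmProdAV_three (h₃ : CMAbelianVarietyRealised) (Θ : Fin 4 → CMType F) :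
    (cmProdAV F h₃ 3 Θ).dim = 2 * Module.finrank ℚ F := by
  rw [dim_cmProdAV h₃ 3 Θ]
  have h2 : Module.finrank ℚ F = 2 * InfinitePlace.nrComplexPlaces F := by
    rw [← InfinitePlace.card_add_two_mul_card_eq_rank, IsTotallyComplex.nrRealPlaces_eq_zero, zero_add]
  omega

/-! ## §2 Codimension-`p` HC on an interpretation, read in the model universe -/

/-- **Per-degree comparison**: if every rational class of Hodge type `(p,p)` in `H^{2p}` of the interpretation of the
code `X` is algebraic, then `U.hodgeClassesOf X p ≤ U.alg X p` in the model universe `U = Model.universeOf hHD hI hU h₃`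
(`U.hodge = BettiUniverse.hodge hHD`, `U.alg = ratAlgebraicClasses`; Milne 1999 p. 72 read at one `p`, exactly as in
`Milne1999.hodgeClasses_le_ratAlgebraicClasses_iff_hodgeConjectureFor`). [cite: Milne1999, §7 p. 72] -/
theorem universeOf_hodgeClassesOf_le_alg_of_forall (hHD : exists_isReal_hodgeModel)
    (hI : hodgePQ_independent_of_hodgeModel) (hU : BallQuotientUniformisedDatum) (h₃ : CMAbelianVarietyRealised)
    (X : PicardCM.Var) (p : ℕ)
    (h : ∀ c : complexBetti (PicardCM.Var.scheme hU h₃ X) (2 * p), IsRationalClass c →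
      IsOfHodgeType X.dim (PicardCM.Var.scheme hU h₃ X) (2 * p) p p c →
        c ∈ algebraicClasses (PicardCM.Var.scheme hU h₃ X) p) :
    (universeOf hHD hI hU h₃).hodgeClassesOf X p ≤ (universeOf hHD hI hU h₃).alg X p := by
  intro v hv
  have hX := PicardCM.Var.isSmoothProjective hU h₃ X
  exact (PicardCM.mem_ratAlgebraicClasses_iff _ p v).2
    (h _ (isRationalClass_ofRatClass v)
      ((BettiUniverse.realHodgeModel hHD hX).isOfHodgeType_of_mem_hodgeClasses hX
        (BettiUniverse.realHodgeModel_isHodgeSymmetric hHD hX) hv))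

/-! ## §3 Codimension two ⟹ `W_RK4` ⟹ `HC_CM` -/

/-- **Codimension-two HC for the corner products gives `U.W_RK4`** (every instance of the model universe): the Weil line
`W_F(P(f))` consists of rational `(2,2)`-classes (`Model.universeOf_fact_weilLine_hodge`, rfwf Lemma 1.2) on the
interpretation `P(f) = ∏_i A_{(F, f.corner i)}` (`Model.scheme_cmProd_universeOf`). [cite: Deligne1982HodgeCycles, §4–§5] -/
theorem w_rk4_of_codimTwo_cmProdAV (hHD : exists_isReal_hodgeModel) (hI : hodgePQ_independent_of_hodgeModel)
    (hU : BallQuotientUniformisedDatum) (h₃ : CMAbelianVarietyRealised)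
    (h2 : ∀ (F : Type) [Field F] [NumberField F] [IsCMField F], IsGalois ℚ F → 6 ≤ Module.finrank ℚ F →
      ∀ (Θ : Fin 4 → CMType F) (c : complexBetti (cmProdAV F h₃ 3 Θ).X (2 * 2)), IsRationalClass c →
        IsOfHodgeType (cmProdAV F h₃ 3 Θ).dim (cmProdAV F h₃ 3 Θ).X (2 * 2) 2 2 c →
          c ∈ algebraicClasses (cmProdAV F h₃ 3 Θ).X 2) :
    (universeOf hHD hI hU h₃).W_RK4 := by
  intro K hG h6 f
  refine (universeOf_fact_weilLine_hodge hHD hI hU h₃ K f).trans ?_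
  rw [CyclotomicSlice.prod4_eq_cmProd]
  refine universeOf_hodgeClassesOf_le_alg_of_forall hHD hI hU h₃ _ 2 ?_
  have hX : PicardCM.Var.scheme hU h₃ ((universeOf hHD hI hU h₃).cmProd K f.corner) = (cmProdAV K h₃ 3 f.corner).X :=
    scheme_cmProd_universeOf hHD hI hU h₃ K 3 f.corner
  have hdim : (cmProdAV K h₃ 3 f.corner).dim = PicardCM.Var.dim ((universeOf hHD hI hU h₃).cmProd K f.corner) := by
    rw [AbelianVariety.dim, ← hX]
    exact schemeDim_eq_holds (PicardCM.Var.isSmoothProjective hU h₃ _)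
  rw [hX, ← hdim]
  exact h2 K hG h6 f.corner

/-- **Codimension-two HC for complex abelian varieties of CM type gives `U.W_RK4`** (every instance).
[cite: Deligne1982HodgeCycles, §4–§5] -/
theorem w_rk4_of_codimTwo (hHD : exists_isReal_hodgeModel) (hI : hodgePQ_independent_of_hodgeModel)
    (hU : BallQuotientUniformisedDatum) (h₃ : CMAbelianVarietyRealised)
    (h2 : ∀ A : AbelianVariety ℂ, IsOfCMType A → ∀ c : complexBetti A.X (2 * 2), IsRationalClass c →
      IsOfHodgeType A.dim A.X (2 * 2) 2 2 c → c ∈ algebraicClasses A.X 2) :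
    (universeOf hHD hI hU h₃).W_RK4 :=
  w_rk4_of_codimTwo_cmProdAV hHD hI hU h₃ fun _ _ _ _ _ _ Θ => h2 _ (isOfCMType_cmProdAV h₃ 3 Θ)

/-- **Codimension two suffices, on the corner products**: `HC_CM` follows from the algebraicity of the rational
`(2,2)`-classes on the products `∏_{j<4} A_{(F,Θ_j)}` of four chosen realisations of CM types of the Galois CM fields `F`
with `[F:ℚ] ≥ 6` (part 3 `hc_cm_of_w_rk4` at the model universe of record).
[cite: Pohlmann1968, Thm. 1] [cite: Andre1992HodgeCM, Théorème (pp. 4–5)] [cite: Milne2020HodgeClassesAV, Theorem 1] -/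
theorem hc_cm_of_codimTwo_cmProdAV
    (h2 : ∀ (F : Type) [Field F] [NumberField F] [IsCMField F], IsGalois ℚ F → 6 ≤ Module.finrank ℚ F →
      ∀ (Θ : Fin 4 → CMType F) (c : complexBetti (cmProdAV F cmAbelianVarietyRealised_holds 3 Θ).X (2 * 2)),
        IsRationalClass c →
        IsOfHodgeType (cmProdAV F cmAbelianVarietyRealised_holds 3 Θ).dim
          (cmProdAV F cmAbelianVarietyRealised_holds 3 Θ).X (2 * 2) 2 2 c →
          c ∈ algebraicClasses (cmProdAV F cmAbelianVarietyRealised_holds 3 Θ).X 2) : HC_CM :=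
  hc_cm_of_w_rk4 exists_isReal_hodgeModel_holds hodgePQ_independent_of_hodgeModel_holds
    (ballQuotientUniformisedDatum_of BallQuotient.ballQuotientUniformised_holds) cmAbelianVarietyRealised_holds
    (w_rk4_of_codimTwo_cmProdAV _ _ _ _ h2)

/-- **Codimension two suffices**: if every rational `(2,2)`-class on every complex abelian variety of CM type is
algebraic, then `HC_CM`. [cite: Pohlmann1968, Thm. 1] [cite: Andre1992HodgeCM, Théorème (pp. 4–5)] [cite: Milne2020HodgeClassesAV, Theorem 1] -/
theorem hc_cm_of_codimTwo
    (h2 : ∀ A : AbelianVariety ℂ, IsOfCMType A → ∀ c : complexBetti A.X (2 * 2), IsRationalClass c →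
      IsOfHodgeType A.dim A.X (2 * 2) 2 2 c → c ∈ algebraicClasses A.X 2) : HC_CM :=
  hc_cm_of_codimTwo_cmProdAV fun _ _ _ _ _ _ Θ => h2 _ (isOfCMType_cmProdAV _ 3 Θ)

/-! ## §4 The equivalences -/

/-- **`HC_CM ⟺ HC_CM in codimension two`**: the Hodge conjecture for complex abelian varieties of CM type is EQUIVALENT
to its codimension-two case — every rational class of Hodge type `(2,2)` in `H⁴(A(ℂ); ℂ)` of every complex abelian variety
`A` of CM type is algebraic.  Neither side is asserted. [cite: Pohlmann1968, Thm. 1] [cite: Andre1992HodgeCM, Théorème (pp. 4–5)]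
[cite: Milne2020HodgeClassesAV, Theorem 1] -/
theorem hc_cm_iff_codimTwo :
    HC_CM ↔ ∀ A : AbelianVariety ℂ, IsOfCMType A → ∀ c : complexBetti A.X (2 * 2), IsRationalClass c →
      IsOfHodgeType A.dim A.X (2 * 2) 2 2 c → c ∈ algebraicClasses A.X 2 :=
  ⟨fun h A hA c hc hpp => (h A AbelianVariety.isSmoothProjective_holds hA).2 2 c hc hpp, hc_cm_of_codimTwo⟩

/-- **`HC_CM ⟺` the rational `(2,2)`-classes on the products of FOUR realisations `∏_{j<4} A_{(F,Θ_j)}`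
(`F` Galois CM, `[F:ℚ] ≥ 6`; abelian varieties of dimension `2[F:ℚ] ≥ 12`, `dim_cmProdAV_three`) are algebraic.**
Neither side is asserted. [cite: Pohlmann1968, Thm. 1] [cite: Andre1992HodgeCM, Théorème (pp. 4–5)] [cite: Milne2020HodgeClassesAV, Theorem 1] -/
theorem hc_cm_iff_codimTwo_cmProdAV :
    HC_CM ↔ ∀ (F : Type) [Field F] [NumberField F] [IsCMField F], IsGalois ℚ F → 6 ≤ Module.finrank ℚ F →
      ∀ (Θ : Fin 4 → CMType F) (c : complexBetti (cmProdAV F cmAbelianVarietyRealised_holds 3 Θ).X (2 * 2)),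
        IsRationalClass c →
        IsOfHodgeType (cmProdAV F cmAbelianVarietyRealised_holds 3 Θ).dim
          (cmProdAV F cmAbelianVarietyRealised_holds 3 Θ).X (2 * 2) 2 2 c →
          c ∈ algebraicClasses (cmProdAV F cmAbelianVarietyRealised_holds 3 Θ).X 2 :=
  ⟨fun h _ _ _ _ _ _ Θ c hc hpp => (hodgeConjectureFor_cmProdAV_of_hc_cm h _ 3 Θ).2 2 c hc hpp, hc_cm_of_codimTwo_cmProdAV⟩

end Summit.HodgeConjecture.CorCM.SliceExhaustion

end
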